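import Summits.ResolutionOfSingularities.ResolutionOfSingularities.Theorems.EquisingularLiftEquisingularLiftNatResidueHypDefs
import HarnessLib

/-!
# [OURS · L1 W4.5(b) · EL♮(3)] RESIDUE HYPOTHESIS DEFS 3 (ND) — DRAFT by res-L1-w45b-idea-1 g20 for the text owner (res-L1-w45b-lead-2), desk ND-TRACK WORD
# 2026-08-28T09:53:58Z (α): the named hypothesis `IsoHypND` / `IsoHypNDWon` of the would-be 4th child `stub_elnat_three_isolated_newtonNondegenerate`
# of the isolated residue (32nd registration, IF adopted after panel).  NOT proposed to the tree by this seat (R21″: successor defs files are the text owner's).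

Content = the definitions of `Cruxes/EquisingularLiftNatThree/NewtonNondegenerateRung.lean` v8 §1 (fan-game primitives `Ray`, `pair`, `Bad`, `star`, `Reach`,
`Won`, `e`, `orthantFan`), §2 (`wt`, `initialForm`), §4 (`IsZeroSetOf`) and §10.1 (`IsLocallyNewtonNondegenerate`, `IsConvenient`, `table`, `dehomogenize`,
`translate`, `FixesOrigin`, `localEquation`, `LocalND`, `LocalNDWon`, `IsoHypND`, `IsoHypNDWon`) VERBATIM, re-homed in the text owner's namespace so that the
registered stub and the Cruxes file share ONE set of declarations (inductive types like `Reach` are not interchangeable across duplicate declarations; after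
this file lands the Cruxes file imports it and drops its copies).  Definitions only: no `sorry`, NO instance (the `Decidable` instances for `Bad` / `IsConvenientTable` used by the kernel certificates are declared in the Cruxes file, not here), no notation; standard
axioms.  OURS; a NAMED HYPOTHESIS, not a statement of any manuscript; AI-written, weaker than expert review.  Lane: `--kind definition --supports
stmt-ResolutionOfSingularities-20148 --as helper` (text owner's call).
-/

set_option linter.dupNamespace false

noncomputable section

open MvPolynomial

namespace Summit.ResolutionOfSingularities.ResolutionOfSingularities.Cruxes.EquisingularLiftNat.Sections

/-! ## Fan-game primitives (v8 §1, §6) -/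

section FanGame

variable {n : ℕ}


/-- Rays of the fan: lattice vectors of `N = ℤⁿ⁺¹/ℤ·𝟙 ≅ ℤⁿ`. -/
abbrev Ray (n : ℕ) := Fin n → ℤ

/-- The pairing `⟨ρ, m⟩` of a ray with a (dehomogenised, `x₀ = 1`) exponent vector. -/
def pair (ρ : Ray n) (m : Fin n → ℕ) : ℤ := ∑ i, ρ i * (m i : ℤ)

/-- «BAD» face = E1-LEGAL centre: NO exponent of `V` minimises `⟨ρ, ·⟩` for all rays `ρ ∈ τ` simultaneously, i.e. the support function
`h_V(ρ) = min_{m ∈ V} ⟨ρ, m⟩` is not linear on the cone `τ` — equivalently (no coefficient hypothesis needed) the orbit closure `V(τ)` lies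
inside the strict transform of `V(F)` for every `F` with support `V`. -/
def Bad (V : Finset (Fin n → ℕ)) (τ : Finset (Ray n)) : Prop :=
  ¬ ∃ m ∈ V, ∀ ρ ∈ τ, ∀ m' ∈ V, pair ρ m ≤ pair ρ m'

/-- Barycentric star subdivision at the face `τ` of a fan recorded by its maximal cones (= the blow-up of the smooth torus-invariant
centre `V(τ)`, Cox–Little–Schenck Prop. 3.3.15; it keeps every cone unimodular). -/
def star (F : Finset (Finset (Ray n))) (τ : Finset (Ray n)) : Finset (Finset (Ray n)) :=
  (F.filter (fun σ => ¬ τ ⊆ σ)) ∪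
    (F.filter (fun σ => τ ⊆ σ)).biUnion (fun σ => τ.image (fun t => insert (∑ ρ ∈ τ, ρ) (σ.erase t)))

/-- Positions reachable from `F` by E1-LEGAL smooth toric blow-ups (star a `Bad` face of a current maximal cone). -/
inductive Reach (V : Finset (Fin n → ℕ)) : Finset (Finset (Ray n)) → Finset (Finset (Ray n)) → Prop
  | refl (F : Finset (Finset (Ray n))) : Reach V F F
  | step (F F' : Finset (Finset (Ray n))) (τ σ : Finset (Ray n)) :
      Reach V F F' → σ ∈ F' → τ ⊆ σ → τ.Nonempty → Bad V τ → Reach V F (star F' τ)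


/-- A position is WON when the support function is linear on every maximal cone (the fan refines the normal fan of the Newton
polytope; then the strict transform of a Newton-nondegenerate hypersurface is smooth and meets every orbit transversally). -/
def Won (V : Finset (Fin n → ℕ)) (F : Finset (Finset (Ray n))) : Prop := ∀ σ ∈ F, ¬ Bad V σ


/-- The standard basis rays `e_i` (the frame members through the point). -/
def e (n : ℕ) (i : Fin n) : Ray n := Pi.single i 1

/-- The LOCAL starting position: the single orthant cone of a point lying on `n` frame members. -/
def orthantFan (n : ℕ) : Finset (Finset (Ray n)) := {Finset.univ.image (e n)}

end FanGame

/-! ## Initial forms (v8 §2) -/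

section Newton

variable {k : Type} [Field k] {N : ℕ}


/-- `w`-weight of an exponent. -/
def wt (w : Fin N → ℤ) (d : Fin N →₀ ℕ) : ℤ := ∑ i, w i * (d i : ℤ)

/-- The initial form `F_w` = sum of the terms of `F` of minimal `w`-weight (the face of the Newton polytope cut out by `w`; `w = 0` gives `F`). -/
def initialForm (w : Fin N → ℤ) (F : MvPolynomial (Fin N) k) : MvPolynomial (Fin N) k :=
  if hF : F.support.Nonempty then
    ∑ d ∈ F.support.filter (fun d => wt w d = F.support.inf' hF (wt w)), monomial d (coeff d F)
  else 0

end Newton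

/-! ## Zero set (v8 §4) -/

section ZeroSet
open CategoryTheory AlgebraicGeometry

/-- `(H, ι)` IS the hypersurface `V₊(F) ⊆ ℙⁿ_k` as a set (all that the conclusion of EL♮ sees of `H`: `Y = range (ι ≫ ℙⁿ_k ↪ ℙⁿ_O)`). -/
def IsZeroSetOf (k : Type) [Field k] (n : ℕ) (H : AlgebraicGeometry.Scheme.{0})
    (ι : H ⟶ (Literature.AlgebraicGeometry.Motives.projectiveSpace n k).left) (F : MvPolynomial (Fin (n + 1)) k) : Prop :=
  letI := MvPolynomial.gradedAlgebra (σ := Fin (n + 1)) (R := k)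
  Set.range ι.base = {y : Proj (homogeneousSubmodule (Fin (n + 1)) k) |
    F ∈ (y : ProjectiveSpectrum (homogeneousSubmodule (Fin (n + 1)) k)).asHomogeneousIdeal}


end ZeroSet

/-! ## The local notions and the named hypotheses (v8 §10.1) -/

section Residue

variable {k : Type} [Field k] {N : ℕ}

/-- **LOCAL Newton nondegeneracy** — Kouchnirenko's condition on the COMPACT faces only: for every POSITIVE integer weight `w` the initial form `g_w`
has no torus point with `g_w = 0 ∧ ∀ i, ∂ᵢ g_w = 0`.  (A positive weight always cuts a compact face of `Γ₊(g) = conv(supp g) + ℝᴺ₊`, and every compact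
face is so cut; the GLOBAL notion `IsNewtonNondegenerate` of §2 — all `w ∈ ℤᴺ` — implies this one, `IsNewtonNondegenerate.isLocally`.)  This is the
hypothesis of the local toric resolution of a CONVENIENT germ (Varchenko 1976 / Kouchnirenko 1976 / Khovanskii 1977; Ishii Thm 4.4.23's chart argument
[corpus:book:ishii1997-introduction-singularities p.96]; Oka for surfaces), at points OVER the singular point only. -/
def IsLocallyNewtonNondegenerate (g : MvPolynomial (Fin N) k) : Prop :=
  ∀ w : Fin N → ℤ, (∀ i, 0 < w i) → ∀ x : Fin N → k, (∀ i, x i ≠ 0) → eval x (initialForm w g) = 0 →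
    (∀ i, eval x (pderiv i (initialForm w g)) = 0) → False

/-- **CONVENIENT** (Kouchnirenko): `g(0) = 0` and a pure power `tᵢ^m`, `m ≥ 1`, of EVERY variable occurs in `g` — the Newton polyhedron meets every
coordinate axis.  Consequence used by the rung: no coordinate face `{eᵢ : i ∈ I}`, `I ⊊ {1..N}`, of the orthant is ever `Bad` (the pure power of a variable
`j ∉ I` minimises all `⟨eᵢ, ·⟩`, `i ∈ I`, simultaneously), so EVERY legal centre of the local game lies over the point. -/
def IsConvenient (g : MvPolynomial (Fin N) k) : Prop :=
  constantCoeff g = 0 ∧ ∀ i : Fin N, ∃ m : ℕ, 0 < m ∧ coeff (Finsupp.single i m) g ≠ 0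

/-- Table form of convenience (DECIDABLE): `0 ∉ A` (the zero vector) and for every `i` some `m·eᵢ ∈ A` with `m ≥ 1`. -/
def IsConvenientTable (A : Finset (Fin N → ℕ)) : Prop :=
  (0 : Fin N → ℕ) ∉ A ∧ ∀ i : Fin N, ∃ v ∈ A, 0 < v i ∧ ∀ j, j ≠ i → v j = 0

/-- The exponent TABLE of a polynomial as plain vectors — the input of the fan game of §1/§6. -/
def table (g : MvPolynomial (Fin N) k) : Finset (Fin N → ℕ) := g.support.image (fun d : Fin N →₀ ℕ => (⇑d : Fin N → ℕ))

variable {n : ℕ}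

/-- Dehomogenisation in the chart `{Xᵢ ≠ 0}` of `ℙⁿ`: `Xᵢ ↦ 1`, `X_{i.succAbove j} ↦ tⱼ` (`j : Fin n`). -/
def dehomogenize (i : Fin (n + 1)) (F : MvPolynomial (Fin (n + 1)) k) : MvPolynomial (Fin n) k :=
  aeval (Fin.insertNth (α := fun _ => MvPolynomial (Fin n) k) i 1 (fun j => X j)) F

/-- Translation of the chart moving its point `b` to the origin: `tⱼ ↦ tⱼ + bⱼ`. -/
def translate (b : Fin n → k) (g : MvPolynomial (Fin n) k) : MvPolynomial (Fin n) k :=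
  aeval (fun j => X j + C (b j)) g

/-- A polynomial automorphism of the chart FIXES THE ORIGIN when it maps the ideal `(t₁, …, tₙ)` into (hence onto) itself. -/
def FixesOrigin (θ : MvPolynomial (Fin n) k ≃ₐ[k] MvPolynomial (Fin n) k) : Prop :=
  ∀ j, constantCoeff (θ (X j)) = 0

/-- THE LOCAL EQUATION of `V₊(F) ⊆ ℙⁿ` at the point with homogeneous coordinates `a`, `aᵢ ≠ 0`, in the polynomial coordinates `θ` of the chart
`{Xᵢ ≠ 0}` centred at that point: `θ (F(t + b)|_{Xᵢ = 1})`, `bⱼ = a_{i.succAbove j} / aᵢ`. -/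
def localEquation (F : MvPolynomial (Fin (n + 1)) k) (a : Fin (n + 1) → k) (i : Fin (n + 1))
    (θ : MvPolynomial (Fin n) k ≃ₐ[k] MvPolynomial (Fin n) k) : MvPolynomial (Fin n) k :=
  θ (translate (fun j => a (i.succAbove j) / a i) (dehomogenize i F))

/-- LOCAL ND DATA of a polynomial germ at the origin: convenient and locally Newton-nondegenerate. -/
def LocalND (g : MvPolynomial (Fin n) k) : Prop :=
  IsConvenient g ∧ IsLocallyNewtonNondegenerate g

/-- LOCAL ND DATA WITH A WON PLAY: additionally SOME E1-legal sequence of stars of the local game (§6: start `orthantFan n`, exponent set `table g`)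
reaches a `Won` position.  Decidable for every explicit table (§10.2: one `decide` through `legalB`); implied by `LocalND` under `FanGameLocal n`
(`localNDWon_of_localND`); it is what lets the 4th-child stub dispense with Molina-Samper's theorem altogether. -/
def LocalNDWon (g : MvPolynomial (Fin n) k) : Prop :=
  LocalND g ∧ ∃ F', Reach (table g) (orthantFan n) F' ∧ Won (table g) F'

open CategoryTheory AlgebraicGeometry in
/-- **`IsoHypND`** (desk ND-TRACK WORD (α)): «EVERY singular point of `H` has a Newton-nondegenerate convenient local equation».  Typed WITHOUT naming
points of `Proj`: some homogeneous `F ≠ 0` cuts out `H` as a set (`IsZeroSetOf`, §4), and for EVERY non-zero `a ∈ kⁿ⁺¹` with `F(a) = 0 ∧ ∇F(a) = 0`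
(a super-set of the singular points of `H` for any such `F`; equal to it when `F` is the reduced equation, which the integral `H` of the crux admits) there
are a chart `{Xᵢ ≠ 0} ∋ a` and an origin-fixing polynomial automorphism `θ` of that chart in which the local equation is CONVENIENT and LOCALLY ND.
Quantifier audit (crit attack list of the desk line): (i) `∀` singular points — yes, via `∀ a`; (ii) non-isolated / positive-dimensional singular locus ⇒
`IsoHypND` is FALSE, not vacuous (convenient + locally ND ⇒ the singular point is isolated, Kouchnirenko; and a non-reduced `F = G^m`, `m ≥ 2`, is never
convenient at a smooth point of `V(G)`), so the `by_cases` sends such `H` to the residue; (iii) coordinate dependence — `∃ i, ∃ θ` over ALL charts and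
ALL polynomial automorphisms (formal/analytic coordinate changes are NOT included: fewer members, same rung); (iv) `p ∣` exponents — detected by the ND
clause itself (§10.2: `x⁴+y⁶+z⁹` is a member for `p ∉ {2,3}` and a NON-member of the decidable layer at `p = 2`).  [OURS · named hypothesis; no
mathematical content of its own; house style R21″: to be carried by the text owner's `…NatResidueHypDefs3`] -/
def IsoHypND (k : Type) [Field k] [IsAlgClosed k] (n : ℕ) (H : AlgebraicGeometry.Scheme.{0})
    (ι : H ⟶ (Literature.AlgebraicGeometry.Motives.projectiveSpace n k).left) : Prop :=
  ∃ (d : ℕ) (F : MvPolynomial (Fin (n + 1)) k), F.IsHomogeneous d ∧ F ≠ 0 ∧ IsZeroSetOf k n H ι F ∧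
    ∀ a : Fin (n + 1) → k, a ≠ 0 → eval a F = 0 → (∀ j, eval a (pderiv j F) = 0) →
      ∃ i : Fin (n + 1), a i ≠ 0 ∧ ∃ θ : MvPolynomial (Fin n) k ≃ₐ[k] MvPolynomial (Fin n) k,
        FixesOrigin θ ∧ LocalND (localEquation F a i θ)

open CategoryTheory AlgebraicGeometry in
/-- **`IsoHypNDWon`** (variant (α′), RECOMMENDED for the registered stub): `IsoHypND` with `LocalNDWon` in place of `LocalND` — each singular point also
carries a won E1-legal play of its local fan game.  Every explicit customer (all 286 Brieskorn–Pham tables of lead-1's PASS-4, the §6 specimens) gets it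
from ONE `decide` (§10.2); under `FanGameLocal n` it is implied by `IsoHypND` (`isoHypNDWon_of_isoHypND`). -/
def IsoHypNDWon (k : Type) [Field k] [IsAlgClosed k] (n : ℕ) (H : AlgebraicGeometry.Scheme.{0})
    (ι : H ⟶ (Literature.AlgebraicGeometry.Motives.projectiveSpace n k).left) : Prop :=
  ∃ (d : ℕ) (F : MvPolynomial (Fin (n + 1)) k), F.IsHomogeneous d ∧ F ≠ 0 ∧ IsZeroSetOf k n H ι F ∧
    ∀ a : Fin (n + 1) → k, a ≠ 0 → eval a F = 0 → (∀ j, eval a (pderiv j F) = 0) →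
      ∃ i : Fin (n + 1), a i ≠ 0 ∧ ∃ θ : MvPolynomial (Fin n) k ≃ₐ[k] MvPolynomial (Fin n) k,
        FixesOrigin θ ∧ LocalNDWon (localEquation F a i θ)

end Residue

end Summit.ResolutionOfSingularities.ResolutionOfSingularities.Cruxes.EquisingularLiftNat.Sections

end
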